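import Mathlib
import Summits.ValiantsHypothesis.ValiantsHypothesis.Theorems.LiouvilleSarnakLiouvilleCutRankStrayWindows

/-!
# Route LiouvilleSarnak — crux `LiouvilleCutRank` (stmt-ValiantsHypothesis-14775):
# SEPARATED ALIGNED BLOCKS — two long opposite runs with bounded junk between them

`Theorems/LiouvilleSarnakCutRankAlignedWindow.lean` (all `W`): a cut word containing an ALIGNED window
`R^L C^L` or `C^L R^L` (`L ≥ L₀(W)`) has rank `≥ W`.
`Theorems/LiouvilleSarnakLiouvilleCutRankStrayWindows.lean` (`StrayRows.le_rank_of_strayWindow`): a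
balanced window of length `2 n₁` (`n₁ ≥ n₀(W, k)`) whose top `n₁ - k` positions are one letter has rank
`≥ W`.

This file lands their common "frontier" form, with NO balance bookkeeping left to the user:

* ★ `le_rank_of_separatedBlocks` — for all `W, j` there is `A = A(W, j)` such that at EVERY level `n`,
  every cut `π` of the `2n` bit positions whose row/column word contains a factor
  `R^a u C^b` or `C^a u R^b` with `a, b ≥ A` and junk `u` of length `j` (ANY word of length `j`)
  has `rank M_π ≥ W` (`M_π(r,c) = λ(N_π(r,c) + 1)`).

Proof: if the junk `u` carries `j_R` row letters and `j_C = j - j_R` column letters, the sub-window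
`R^{a'} u C^{b'}` with `a' + j_R = b' + j_C` (`a' = N + (j - 2 j_R)`, `b' = N + (2 j_R - j)`,
truncated subtractions) is balanced of level `n₁ = a' + j_R ≥ N`, and its top `b' = n₁ - j_C` positions are
column letters; so `le_rank_of_strayWindow W j_C` applies once `N ≥ n₀(W, k)` for every `k ≤ j`
(`exists_uniform_threshold`).  The mirror case is the same with the letters exchanged.

Consequence for the OPEN crux (honest framing): for fixed `W`, a bad cut word (rank `< W`) at any level
contains no two opposite runs of lengths `≥ A(W, j)` at distance `j`, for every `j`; in particular
(`j = 0`) adjacent runs have `min < A(W, 0)`.  The remaining (open) class is that of finely interleaved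
words such as `(RC)^{n}`; the crux `LiouvilleCutRank` for general cuts, `DigitalBilinearLiouville` and
`AlgebraicSarnak` stay OPEN, and nothing here bears on VP versus VNP.  No definitions.
[cite: Coons2011, Theorem 1.5]
-/

-- the directory `ValiantsHypothesis/ValiantsHypothesis` repeats the summit name (tree layout)
set_option linter.dupNamespace false

namespace Summit.ValiantsHypothesis.ValiantsHypothesis.Theorems.LiouvilleSarnakLiouvilleCutRank.SeparatedBlocks

open ArithmeticFunction

open Summit.ValiantsHypothesis.ValiantsHypothesis.Theorems.LiouvilleSarnakLiouvilleCutRank.StrayRows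
  (le_rank_of_strayWindow)

/-- **A threshold uniform in the number of strays `k ≤ j`.**  One level bound `N = N(W, j)` such that
`StrayRows.le_rank_of_strayWindow W k` holds from level `N` on for every `k ≤ j`. [folklore] -/
theorem exists_uniform_threshold (W j : ℕ) : ∃ N : ℕ, ∀ k : ℕ, k ≤ j → ∀ n₁ : ℕ, N ≤ n₁ →
    ∀ (n : ℕ) (π : Fin n ⊕ Fin n ≃ Fin (2 * n)) (s : ℕ), s + 2 * n₁ ≤ 2 * n →
      Nat.count (fun k' => (if h : s + k' < 2 * n then (π.symm ⟨s + k', h⟩).isLeft else false) = true)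
        (2 * n₁) = n₁ →
      ((∀ j : Fin (2 * n), s + (n₁ + k) ≤ (j : ℕ) → (j : ℕ) < s + 2 * n₁ → (π.symm j).isLeft = true) ∨
       (∀ j : Fin (2 * n), s + (n₁ + k) ≤ (j : ℕ) → (j : ℕ) < s + 2 * n₁ → (π.symm j).isRight = true)) →
      W ≤ (Matrix.of fun r c : Fin n → Bool =>
        (((liouville (Nat.ofBits (fun j : Fin (2 * n) => Sum.elim r c (π.symm j)) + 1) : ℤ) :
          ℂ))).rank := by
  choose f hf using fun k => le_rank_of_strayWindow W k
  refine ⟨∑ k ∈ Finset.range (j + 1), f k, fun k hk n₁ hn₁ => hf k n₁ (le_trans ?_ hn₁)⟩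
  exact Finset.single_le_sum (f := f) (fun _ _ => Nat.zero_le _)
    (Finset.mem_range.mpr (Nat.lt_succ_of_le hk))

/-- **Rows below, columns above.**  For all `W, j` there is `A` such that at every level `n`, every cut
`π` whose word has `a ≥ A` consecutive row positions `p, …, p + a - 1`, then `j` arbitrary positions,
then `b ≥ A` consecutive column positions, has `rank M_π ≥ W`. [folklore] -/
theorem le_rank_of_rowsBelowCols (W j : ℕ) : ∃ A : ℕ, ∀ (n : ℕ) (π : Fin n ⊕ Fin n ≃ Fin (2 * n))
    (p a b : ℕ), p + a + j + b ≤ 2 * n → A ≤ a → A ≤ b →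
    (∀ i : Fin (2 * n), p ≤ (i : ℕ) → (i : ℕ) < p + a → (π.symm i).isLeft = true) →
    (∀ i : Fin (2 * n), p + a + j ≤ (i : ℕ) → (i : ℕ) < p + a + j + b → (π.symm i).isRight = true) →
    W ≤ (Matrix.of fun r c : Fin n → Bool =>
      (((liouville (Nat.ofBits (fun j : Fin (2 * n) => Sum.elim r c (π.symm j)) + 1) : ℤ) :
        ℂ))).rank := by
  obtain ⟨N, hN⟩ := exists_uniform_threshold W j
  refine ⟨N + j, fun n π p a b hle ha hb hrows hcols => ?_⟩
  -- the row/column word of `π` (`true` = row bit), extended by `false`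
  set w : ℕ → Bool := fun k' => if h : k' < 2 * n then (π.symm ⟨k', h⟩).isLeft else false with hw
  -- number of row letters in the junk
  set jR : ℕ := Nat.count (fun k' => w (p + a + k') = true) j with hjR
  have hjR_le : jR ≤ j := by rw [hjR]; exact Nat.count_le _
  -- the balanced sub-window `R^{a'} u C^{b'}`
  set a' : ℕ := N + (j - 2 * jR) with ha'
  set b' : ℕ := N + (2 * jR - j) with hb'
  set n₁ : ℕ := a' + jR with hn₁
  have ha'a : a' ≤ a := by omega
  have hb'b : b' ≤ b := by omega
  have h2n₁ : 2 * n₁ = a' + j + b' := by omega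
  have hNn₁ : N ≤ n₁ := by omega
  set s : ℕ := p + a - a' with hs
  have hsa : s + a' = p + a := by omega
  have hsle : s + 2 * n₁ ≤ 2 * n := by omega
  -- the sub-window is balanced
  have hcount : Nat.count (fun k' => w (s + k') = true) (2 * n₁) = n₁ := by
    rw [h2n₁, Nat.count_add, Nat.count_add]
    have h1 : Nat.count (fun k' => w (s + k') = true) a' = a' := by
      refine Nat.count_iff_forall.mpr fun k' hk' => ?_
      have hlt : s + k' < 2 * n := by omega
      simp only [hw, dif_pos hlt]
      exact hrows ⟨s + k', hlt⟩ (by simp only; omega) (by simp only; omega)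
    have h2 : Nat.count (fun k' => w (s + (a' + k')) = true) j = jR := by
      rw [hjR]
      congr 1
      funext k'
      rw [show s + (a' + k') = p + a + k' by omega]
    have h3 : Nat.count (fun k' => w (s + (a' + j + k')) = true) b' = 0 := by
      refine Nat.count_iff_forall_not.mpr fun k' hk' => ?_
      have hlt : s + (a' + j + k') < 2 * n := by omega
      simp only [hw, dif_pos hlt]
      have := hcols ⟨s + (a' + j + k'), hlt⟩ (by simp only; omega) (by simp only; omega)
      rw [← Sum.not_isLeft] at this
      simpa using this
    rw [h1, h2, h3]
    omega
  -- its top `b' = n₁ - (j - jR)` positions are column bits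
  have htop : ∀ i : Fin (2 * n), s + (n₁ + (j - jR)) ≤ (i : ℕ) → (i : ℕ) < s + 2 * n₁ →
      (π.symm i).isRight = true :=
    fun i hi hi' => hcols i (by omega) (by omega)
  exact hN (j - jR) (by omega) n₁ hNn₁ n π s hsle hcount (Or.inr htop)

/-- **Columns below, rows above** (the mirror case). [folklore] -/
theorem le_rank_of_colsBelowRows (W j : ℕ) : ∃ A : ℕ, ∀ (n : ℕ) (π : Fin n ⊕ Fin n ≃ Fin (2 * n))
    (p a b : ℕ), p + a + j + b ≤ 2 * n → A ≤ a → A ≤ b →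
    (∀ i : Fin (2 * n), p ≤ (i : ℕ) → (i : ℕ) < p + a → (π.symm i).isRight = true) →
    (∀ i : Fin (2 * n), p + a + j ≤ (i : ℕ) → (i : ℕ) < p + a + j + b → (π.symm i).isLeft = true) →
    W ≤ (Matrix.of fun r c : Fin n → Bool =>
      (((liouville (Nat.ofBits (fun j : Fin (2 * n) => Sum.elim r c (π.symm j)) + 1) : ℤ) :
        ℂ))).rank := by
  obtain ⟨N, hN⟩ := exists_uniform_threshold W j
  refine ⟨N + j, fun n π p a b hle ha hb hcols hrows => ?_⟩
  set w : ℕ → Bool := fun k' => if h : k' < 2 * n then (π.symm ⟨k', h⟩).isLeft else false with hw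
  set jR : ℕ := Nat.count (fun k' => w (p + a + k') = true) j with hjR
  have hjR_le : jR ≤ j := by rw [hjR]; exact Nat.count_le _
  -- the balanced sub-window `C^{a'} u R^{b'}`: `a' + (j - jR) = jR + b'` letters of each kind
  set a' : ℕ := N + (2 * jR - j) with ha'
  set b' : ℕ := N + (j - 2 * jR) with hb'
  set n₁ : ℕ := b' + jR with hn₁
  have ha'a : a' ≤ a := by omega
  have hb'b : b' ≤ b := by omega
  have h2n₁ : 2 * n₁ = a' + j + b' := by omega
  have hNn₁ : N ≤ n₁ := by omega
  set s : ℕ := p + a - a' with hs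
  have hsa : s + a' = p + a := by omega
  have hsle : s + 2 * n₁ ≤ 2 * n := by omega
  have hcount : Nat.count (fun k' => w (s + k') = true) (2 * n₁) = n₁ := by
    rw [h2n₁, Nat.count_add, Nat.count_add]
    have h1 : Nat.count (fun k' => w (s + k') = true) a' = 0 := by
      refine Nat.count_iff_forall_not.mpr fun k' hk' => ?_
      have hlt : s + k' < 2 * n := by omega
      simp only [hw, dif_pos hlt]
      have := hcols ⟨s + k', hlt⟩ (by simp only; omega) (by simp only; omega)
      rw [← Sum.not_isLeft] at this
      simpa using this
    have h2 : Nat.count (fun k' => w (s + (a' + k')) = true) j = jR := by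
      rw [hjR]
      congr 1
      funext k'
      rw [show s + (a' + k') = p + a + k' by omega]
    have h3 : Nat.count (fun k' => w (s + (a' + j + k')) = true) b' = b' := by
      refine Nat.count_iff_forall.mpr fun k' hk' => ?_
      have hlt : s + (a' + j + k') < 2 * n := by omega
      simp only [hw, dif_pos hlt]
      exact hrows ⟨s + (a' + j + k'), hlt⟩ (by simp only; omega) (by simp only; omega)
    rw [h1, h2, h3]
    omega
  have htop : ∀ i : Fin (2 * n), s + (n₁ + jR) ≤ (i : ℕ) → (i : ℕ) < s + 2 * n₁ →
      (π.symm i).isLeft = true :=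
    fun i hi hi' => hrows i (by omega) (by omega)
  exact hN jR hjR_le n₁ hNn₁ n π s hsle hcount (Or.inl htop)

/-- ★ **Separated aligned blocks.**  For all `W, j` there is `A = A(W, j)` such that at EVERY level `n`,
every cut `π` of the `2n` bit positions whose row/column word contains, starting at some position `p`,
a run of `a ≥ A` equal letters, then `j` arbitrary letters, then a run of `b ≥ A` letters of the OTHER
kind, has `rank M_π ≥ W`, `M_π(r,c) = λ(N_π(r,c) + 1)`.  (`j = 0`: the aligned-window theorem; the
junk may be anything, only its length enters `A`.)  Equivalently: for fixed `W`, a cut word of rank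
`< W` has no two opposite runs of lengths `≥ A(W, j)` at distance exactly `j`, for any `j`.
[cite: Coons2011, Theorem 1.5] -/
theorem le_rank_of_separatedBlocks (W j : ℕ) : ∃ A : ℕ, ∀ (n : ℕ) (π : Fin n ⊕ Fin n ≃ Fin (2 * n))
    (p a b : ℕ), p + a + j + b ≤ 2 * n → A ≤ a → A ≤ b →
    ((∀ i : Fin (2 * n), p ≤ (i : ℕ) → (i : ℕ) < p + a → (π.symm i).isLeft = true) ∧
      (∀ i : Fin (2 * n), p + a + j ≤ (i : ℕ) → (i : ℕ) < p + a + j + b → (π.symm i).isRight = true) ∨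
     (∀ i : Fin (2 * n), p ≤ (i : ℕ) → (i : ℕ) < p + a → (π.symm i).isRight = true) ∧
      (∀ i : Fin (2 * n), p + a + j ≤ (i : ℕ) → (i : ℕ) < p + a + j + b → (π.symm i).isLeft = true)) →
    W ≤ (Matrix.of fun r c : Fin n → Bool =>
      (((liouville (Nat.ofBits (fun j : Fin (2 * n) => Sum.elim r c (π.symm j)) + 1) : ℤ) :
        ℂ))).rank := by
  obtain ⟨A₁, hA₁⟩ := le_rank_of_rowsBelowCols W j
  obtain ⟨A₂, hA₂⟩ := le_rank_of_colsBelowRows W j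
  refine ⟨max A₁ A₂, fun n π p a b hle ha hb h => ?_⟩
  rcases h with ⟨hrows, hcols⟩ | ⟨hcols, hrows⟩
  · exact hA₁ n π p a b hle (le_of_max_le_left ha) (le_of_max_le_left hb) hrows hcols
  · exact hA₂ n π p a b hle (le_of_max_le_right ha) (le_of_max_le_right hb) hcols hrows

end Summit.ValiantsHypothesis.ValiantsHypothesis.Theorems.LiouvilleSarnakLiouvilleCutRank.SeparatedBlocks
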